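import Mathlib

/-!
# Tier 7 — LINE 3 support: the Fock wedge at `ι₁` — two linearly independent `(1,0)`-vertex forms have a non-zero
`Λ²`-component (`Line3/FockWedge.lean`; t7-L1-p1, gen 4; census item U3, lead l. 15516; Mathlib only)

Memo §4a (b): at the definite place `ι₁` the Fock model of the oscillator representation on `S(V ⊗ W_A)` is the algebra of
polynomials in the variables `z_{ai}` (`a` the `V⁺`-index, `i` the `W_A`-column) times the Gaussian; the theta lift of the vertex
character `μ_i` has the Fock vector `φ_i = (a linear form in the column `i`) · Gaussian`, and the cup product
`θ(μ₀) ∪ θ(μ₁)` in `H^{2,0}` is the WEDGE — the `Λ² ⊗ Λ²`-component of the bidegree-`(1,1)` product `φ₀ φ₁` under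
`U(2)_W × U(2,1)`, i.e. the part of `φ₀ φ₁` antisymmetric under the exchange of the two tensor factors. On the bidegree-`(1,1)`
space `z_{a0} z_{b1} ↔ e_a ⊗ e_b ∈ V⁺ ⊗ V⁺` that exchange is the COLUMN SWAP `z_{ai} ↦ z_{a(1−i)}` (an algebra automorphism of
the Fock algebra; transposing the `V⁺`-factors and transposing the `W_A`-columns agree on a commutative product), with
`+1`-eigenspace `Sym²V ⊗ Sym²W` and `−1`-eigenspace `Λ²V ⊗ Λ²W`. THIS FILE types the finite-dimensional statement (`e_ne`):
with `vertexForm c i := Σ_a c_a z_{ai}` (`φ_i` with coefficient vector `c`) and `antisym` the antisymmetrisation under the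
column swap,
`antisym (vertexForm c 0 · vertexForm d 1) = ½ (c₀ d₁ − c₁ d₀) · (z₀₀ z₁₁ − z₁₀ z₀₁)`, so it is non-zero iff the two coefficient vectors `c, d`
are linearly independent (`antisym_mul_vertexForm_ne_zero_iff_linearIndependent`). The Gaussian factor is suppressed (it is a unit
of the Schwartz space, common to all vectors); the identification of `vertexForm c 0`, `vertexForm d 1` with `θ(μ₀)_{ι₁}`, `θ(μ₁)_{ι₁}` and of
the antisymmetrisation with the `Λ²(𝔭⁺)^*`-component (the `U(2)_W`-character `τ`) is (H8) / the dictionary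
(TYPING-CENSUS T7); nothing about (N) or (P). [M]-level model consolidation (REPAIR-CENSUS §C U3); it does not change the
residual in kind. Sorry-free; axioms: propext / Classical.choice / Quot.sound. §8(d): uses an L-value-free non-vanishing
device: NO.
-/

namespace Summit.Ventures.HodgeRepro2.Tier7.Line3.FockWedge

open MvPolynomial

noncomputable section

/-- the variable index `(a, i)`: `a : Fin 2` the `V⁺`-index, `i : Fin 2` the `W_A`-column -/
abbrev Idx := Fin 2 × Fin 2

/-- the Fock polynomial algebra at `ι₁`: polynomials in `z_{ai}` over `ℂ` (the Gaussian suppressed) -/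
abbrev Fock := MvPolynomial Idx ℂ

/-- the vertex form of the column `i` with coefficient vector `c`: `Σ_a c_a z_{ai}` -/
def vertexForm (c : Fin 2 → ℂ) (i : Fin 2) : Fock := ∑ a, C (c a) * X (a, i)

/-- the swap of the two `W_A`-columns on the variables, `(a, i) ↦ (a, 1 − i)` -/
def swapIdx : Idx → Idx := Prod.map id (Equiv.swap (0 : Fin 2) 1)

/-- `swapIdx` is an involution -/
theorem swapIdx_swapIdx (p : Idx) : swapIdx (swapIdx p) = p := by
  rcases p with ⟨a, i⟩
  simp [swapIdx]

/-- the column swap as an algebra automorphism of the Fock algebra (on bidegree `(1,1)`: the exchange of the two tensor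
factors of `V⁺ ⊗ V⁺`) -/
def swap : Fock →ₐ[ℂ] Fock := rename swapIdx

/-- on a variable: `z_{ai} ↦ z_{a(1−i)}` -/
theorem swap_X (a i : Fin 2) : swap (X (a, i)) = X (a, Equiv.swap (0 : Fin 2) 1 i) := rename_X _ _

/-- on a constant: `swap (C r) = C r` -/
theorem swap_C (r : ℂ) : swap (C r) = C r := rename_C _ _

/-- `swap` is an involution -/
theorem swap_swap (P : Fock) : swap (swap P) = P := by
  simp only [swap, rename_rename]
  have h : swapIdx ∘ swapIdx = id := funext swapIdx_swapIdx
  rw [h, rename_id, AlgHom.id_apply]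

/-- the symmetrisation under the column swap, `P ↦ ½ (P + swap P)` — on the bidegree-`(1,1)` space the projector onto
`Sym²V ⊗ Sym²W` -/
def sym (P : Fock) : Fock := C (1 / 2 : ℂ) * (P + swap P)

/-- the antisymmetrisation under the column swap, `P ↦ ½ (P − swap P)` — on the bidegree-`(1,1)` space the projector onto
the line `Λ²V ⊗ Λ²W` spanned by the wedge -/
def antisym (P : Fock) : Fock := C (1 / 2 : ℂ) * (P - swap P)

/-- `½ + ½ = 1` in the Fock algebra -/
theorem C_half_add_C_half : (C (1 / 2 : ℂ) : Fock) + C (1 / 2) = 1 := by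
  rw [← C_add, ← C_1]
  norm_num

/-- `P = sym P + antisym P` -/
theorem sym_add_antisym (P : Fock) : sym P + antisym P = P := by
  unfold sym antisym
  calc C (1 / 2 : ℂ) * (P + swap P) + C (1 / 2) * (P - swap P) = (C (1 / 2 : ℂ) + C (1 / 2)) * P := by ring
    _ = P := by rw [C_half_add_C_half, one_mul]

/-- the antisymmetric part is `swap`-odd -/
theorem swap_antisym (P : Fock) : swap (antisym P) = -antisym P := by
  unfold antisym
  rw [map_mul, map_sub, swap_swap, swap_C]
  ring

/-- the symmetric part is `swap`-even -/
theorem swap_sym (P : Fock) : swap (sym P) = sym P := by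
  unfold sym
  rw [map_mul, map_add, swap_swap, swap_C]
  ring

/-- `antisym` is a projector -/
theorem antisym_antisym (P : Fock) : antisym (antisym P) = antisym P := by
  show C (1 / 2 : ℂ) * (antisym P - swap (antisym P)) = antisym P
  rw [swap_antisym, sub_neg_eq_add]
  calc C (1 / 2 : ℂ) * (antisym P + antisym P) = (C (1 / 2 : ℂ) + C (1 / 2)) * antisym P := by ring
    _ = antisym P := by rw [C_half_add_C_half, one_mul]

/-- `sym` is a projector -/
theorem sym_sym (P : Fock) : sym (sym P) = sym P := by
  show C (1 / 2 : ℂ) * (sym P + swap (sym P)) = sym P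
  rw [swap_sym]
  calc C (1 / 2 : ℂ) * (sym P + sym P) = (C (1 / 2 : ℂ) + C (1 / 2)) * sym P := by ring
    _ = sym P := by rw [C_half_add_C_half, one_mul]

/-- the wedge monomial `z₀₀ z₁₁ − z₁₀ z₀₁` -/
def wedge : Fock := X ((0 : Fin 2), (0 : Fin 2)) * X (1, 1) - X (1, 0) * X (0, 1)

/-- the wedge monomial is not zero (evaluate at `z₀₀ = z₁₁ = 1`, `z₁₀ = z₀₁ = 0`) -/
theorem wedge_ne_zero : wedge ≠ 0 := by
  intro h
  have := congrArg (eval fun p : Idx => if p.1 = p.2 then (1 : ℂ) else 0) h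
  simp [wedge] at this

/-- the wedge is `swap`-odd (it spans the `Λ² ⊗ Λ²`-line of the bidegree-`(1,1)` space) -/
theorem swap_wedge : swap wedge = -wedge := by
  unfold wedge
  simp only [map_sub, map_mul, swap_X, Equiv.swap_apply_left, Equiv.swap_apply_right]
  ring

/-- **THE `Λ²`-COMPONENT OF THE `(1,1)`-PRODUCT IS THE DETERMINANT TIMES THE WEDGE**:
`antisym (vertexForm c 0 · vertexForm d 1) = ½ (c₀ d₁ − c₁ d₀) · (z₀₀ z₁₁ − z₁₀ z₀₁)` -/
theorem antisym_mul_vertexForm (c d : Fin 2 → ℂ) :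
    antisym (vertexForm c 0 * vertexForm d 1) = C ((1 / 2 : ℂ) * (c 0 * d 1 - c 1 * d 0)) * wedge := by
  unfold antisym vertexForm wedge
  simp only [Fin.sum_univ_two, map_mul, map_add, swap_X, swap_C, Equiv.swap_apply_left,
    Equiv.swap_apply_right, C_sub]
  ring

/-- the `Λ²`-component of `vertexForm c 0 · vertexForm d 1` is non-zero iff the determinant `c₀ d₁ − c₁ d₀` is -/
theorem antisym_mul_vertexForm_ne_zero_iff (c d : Fin 2 → ℂ) :
    antisym (vertexForm c 0 * vertexForm d 1) ≠ 0 ↔ c 0 * d 1 - c 1 * d 0 ≠ 0 := by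
  rw [antisym_mul_vertexForm, mul_ne_zero_iff, C_ne_zero]
  constructor
  · intro h h0
    apply h.1
    rw [h0, mul_zero]
  · intro h
    exact ⟨mul_ne_zero (by norm_num) h, wedge_ne_zero⟩

/-- the determinant `c₀ d₁ − c₁ d₀` of two vectors of `ℂ²` is non-zero iff they are linearly independent -/
theorem det_ne_zero_iff_linearIndependent (c d : Fin 2 → ℂ) :
    c 0 * d 1 - c 1 * d 0 ≠ 0 ↔ LinearIndependent ℂ ![c, d] := by
  have h : LinearIndependent ℂ ![c, d] ↔ IsUnit (Matrix.of ![c, d]) := by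
    rw [← Matrix.linearIndependent_rows_iff_isUnit]
    rfl
  rw [h, Matrix.isUnit_iff_isUnit_det, isUnit_iff_ne_zero, Matrix.det_fin_two]
  simp only [Matrix.of_apply, Matrix.cons_val_zero, Matrix.cons_val_one]

/-- **TWO LINEARLY INDEPENDENT `(1,0)`-VERTEX FORMS HAVE A NON-ZERO WEDGE** (memo §4a (b), `e_ne`):
`antisym (vertexForm c 0 · vertexForm d 1) ≠ 0 ↔ LinearIndependent ℂ ![c, d]` -/
theorem antisym_mul_vertexForm_ne_zero_iff_linearIndependent (c d : Fin 2 → ℂ) :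
    antisym (vertexForm c 0 * vertexForm d 1) ≠ 0 ↔ LinearIndependent ℂ ![c, d] := by
  rw [antisym_mul_vertexForm_ne_zero_iff, det_ne_zero_iff_linearIndependent]

/-- a linear substitution `c ↦ g c` of the `V⁺`-index multiplies the determinant `c₀ d₁ − c₁ d₀` by `det g` -/
theorem det_pair_mulVec (g : Matrix (Fin 2) (Fin 2) ℂ) (c d : Fin 2 → ℂ) :
    (g.mulVec c) 0 * (g.mulVec d) 1 - (g.mulVec c) 1 * (g.mulVec d) 0 = g.det * (c 0 * d 1 - c 1 * d 0) := by
  simp only [Matrix.mulVec, dotProduct, Fin.sum_univ_two, Matrix.det_fin_two]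
  ring

/-- **THE `Λ²`-COMPONENT TRANSFORMS BY `det g`** under a linear substitution of the `V⁺`-index — the character
`Λ²(𝔭⁺)^* = det` of `U(2)` on the wedge line -/
theorem antisym_mul_vertexForm_mulVec (g : Matrix (Fin 2) (Fin 2) ℂ) (c d : Fin 2 → ℂ) :
    antisym (vertexForm (g.mulVec c) 0 * vertexForm (g.mulVec d) 1)
      = C g.det * antisym (vertexForm c 0 * vertexForm d 1) := by
  rw [antisym_mul_vertexForm, antisym_mul_vertexForm, det_pair_mulVec, ← mul_assoc (C g.det), ← C_mul]
  congr 2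
  ring

/-- proportional vertex forms (`d = t • c`) have zero wedge -/
theorem antisym_mul_vertexForm_smul (c : Fin 2 → ℂ) (t : ℂ) :
    antisym (vertexForm c 0 * vertexForm (t • c) 1) = 0 := by
  rw [antisym_mul_vertexForm]
  have : c 0 * (t • c) 1 - c 1 * (t • c) 0 = 0 := by simp only [Pi.smul_apply, smul_eq_mul]; ring
  rw [this, mul_zero, C_0, zero_mul]

end

end Summit.Ventures.HodgeRepro2.Tier7.Line3.FockWedge
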